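import Mathlib
import HarnessLib

/-!
# Asymptotic velocities from integrable escape rates (stub `stub_asymptoticVelocity`)

Step (A) of the line E → A → B for the crux `DispersingCapture` (route `DissipativeFinalMotions`):
the dissipative Marchal–Saari "final velocities" lemma, pure real analysis. `N` curves
`ξᵢ ∈ C²(ℝ, ℝ³)`, `δ`-separated (`δ > 0`) and `V`-Lipschitz on `[T, ∞)`, obeying the near-Newtonian
modulation law `‖ξ̈ᵢ + Σ_{j≠i} Mⱼ(ξᵢ − ξⱼ)/dᵢⱼ³‖ ≤ κ Σ_{j≠i} (Mⱼ/dᵢⱼ²)(‖ξ̇ᵢ‖² + ‖ξ̇ⱼ‖² + (Σₗ Mₗ)/dᵢⱼ) + β`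
with `β` integrable on `[T, ∞)`, and whose pairwise escape rates `1/dᵢⱼ²` are integrable on `[T, ∞)`,
have asymptotic velocities `vᵢ`: `‖vᵢ‖ ≤ V`, `ξ̇ᵢ → vᵢ` and `t⁻¹ ξᵢ(t) → vᵢ`.

Proof. (1) The one-sided Lipschitz bound and differentiability give the closed speed bound
`‖ξ̇ᵢ(t)‖ ≤ V` on `[T, ∞)` (right difference quotients). (2) The law then dominates the acceleration
on `[T, ∞)` by the integrable `(1 + |κ|(2V² + |Σₗ Mₗ|/δ)) Σ_{j≠i} |Mⱼ|/dᵢⱼ² + β`, so `ξ̈ᵢ` is integrable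
on `[T, ∞)`. (3) The fundamental theorem of calculus and the improper-integral limit give
`ξ̇ᵢ(t) → vᵢ := ξ̇ᵢ(T) + ∫_{(T,∞)} ξ̈ᵢ`. (4) `‖vᵢ‖ ≤ V` since the bound is closed. (5) The Cesàro statement
`t⁻¹ ξᵢ(t) → vᵢ` follows from the mean value inequality applied to the drift `s ↦ ξᵢ(s) − s vᵢ`.
-/

set_option linter.dupNamespace false

noncomputable section

open Filter Set MeasureTheory
open scoped Topology

namespace Summit.FinalStateConjecture.FinalStateConjecture.Theorems.DissipativeFinalMotions.DispersingCapture

variable {E : Type*} [NormedAddCommGroup E] [NormedSpace ℝ E]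

/-- Speed bound from a one-sided Lipschitz estimate: if `‖f z - f t‖ ≤ V (z - t)` for all `z > t`
and `f` is differentiable at `t`, then `‖f'(t)‖ ≤ V` (limit of right difference quotients). -/
private theorem norm_deriv_le_of_right_lipschitz {f : ℝ → E} {V t : ℝ}
    (hf : DifferentiableAt ℝ f t) (h : ∀ z, t < z → ‖f z - f t‖ ≤ V * (z - t)) :
    ‖deriv f t‖ ≤ V := by
  have h1 : Tendsto (slope f t) (𝓝[>] t) (𝓝 (deriv f t)) := by
    have h' := hf.hasDerivAt.hasDerivWithinAt (s := Set.Ioi t)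
    rwa [hasDerivWithinAt_iff_tendsto_slope' Set.self_notMem_Ioi] at h'
  have h2 : ∀ᶠ z in 𝓝[>] t, ‖slope f t z‖ ≤ V := by
    filter_upwards [self_mem_nhdsWithin] with z hz
    have hz' : 0 < z - t := sub_pos.2 hz
    rw [slope_def_module, norm_smul, norm_inv, Real.norm_eq_abs, abs_of_pos hz',
      inv_mul_le_iff₀ hz']
    calc ‖f z - f t‖ ≤ V * (z - t) := h z hz
      _ = (z - t) * V := mul_comm _ _
  exact le_of_tendsto h1.norm h2

/-- Cesàro step: if `f` is differentiable on `ℝ` with `f' → v` at `+∞`, then `t⁻¹ • f t → v`.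
Mean value inequality for the drift `s ↦ f s - s • v`, whose derivative `f' s - v` is eventually
small. -/
private theorem tendsto_inv_smul_of_tendsto_deriv {f : ℝ → E} {v : E} (hf : Differentiable ℝ f)
    (hv : Tendsto (deriv f) atTop (𝓝 v)) : Tendsto (fun t : ℝ => t⁻¹ • f t) atTop (𝓝 v) := by
  rw [Metric.tendsto_atTop]
  intro ε hε
  obtain ⟨t₀, ht₀⟩ := Metric.tendsto_atTop.1 hv (ε / 3) (by positivity)
  obtain ⟨t₁, h₀₁, h₁⟩ : ∃ t₁ : ℝ, t₀ ≤ t₁ ∧ 1 ≤ t₁ := ⟨max t₀ 1, le_max_left _ _, le_max_right _ _⟩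
  have ht₁pos : 0 < t₁ := one_pos.trans_le h₁
  have hφ : ∀ s, HasDerivAt (fun s => f s - s • v) (deriv f s - v) s := fun s => by
    have h := (hf s).hasDerivAt.fun_sub ((hasDerivAt_id' s).smul_const v)
    rwa [one_smul] at h
  have hmv : ∀ t, t₁ ≤ t → ‖(f t - t • v) - (f t₁ - t₁ • v)‖ ≤ ε / 3 * (t - t₁) := by
    intro t ht
    refine norm_image_sub_le_of_norm_deriv_le_segment' (f := fun s => f s - s • v)
      (fun s _ => (hφ s).hasDerivWithinAt) (fun s hs => ?_) t (Set.right_mem_Icc.2 ht)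
    have h := ht₀ s (h₀₁.trans hs.1)
    rw [dist_eq_norm] at h
    exact h.le
  refine ⟨max t₁ (3 * ‖f t₁ - t₁ • v‖ / ε + 1), fun t ht => ?_⟩
  have ht1 : t₁ ≤ t := (le_max_left _ _).trans ht
  have htpos : 0 < t := ht₁pos.trans_le ht1
  have ht2 : 3 * ‖f t₁ - t₁ • v‖ / ε < t := by
    have h := (le_max_right _ _).trans ht
    linarith
  have h3 : 3 * ‖f t₁ - t₁ • v‖ < t * ε := (div_lt_iff₀ hε).1 ht2
  have hkey : t⁻¹ • f t - v = t⁻¹ • (f t - t • v) := by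
    rw [smul_sub, smul_smul, inv_mul_cancel₀ htpos.ne', one_smul]
  rw [dist_eq_norm, hkey, norm_smul, norm_inv, Real.norm_eq_abs, abs_of_pos htpos,
    inv_mul_eq_div, div_lt_iff₀ htpos]
  have h4 : 0 < ε * t₁ := mul_pos hε ht₁pos
  have h5 : 0 < ε * t := mul_pos hε htpos
  calc ‖f t - t • v‖ ≤ ‖f t₁ - t₁ • v‖ + ‖(f t - t • v) - (f t₁ - t₁ • v)‖ :=
        norm_le_norm_add_norm_sub' _ _
    _ ≤ ‖f t₁ - t₁ • v‖ + ε / 3 * (t - t₁) := add_le_add le_rfl (hmv t ht1)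
    _ < ε * t := by linarith

/-- FTC step: a `C²` curve whose acceleration is integrable on `(T, ∞)` has the limiting velocity
`f'(T) + ∫_{(T, ∞)} f''`. -/
private theorem tendsto_deriv_of_integrableOn [CompleteSpace E] {f : ℝ → E} {T : ℝ}
    (hf : ContDiff ℝ 2 f) (hint : IntegrableOn (deriv (deriv f)) (Set.Ioi T)) :
    Tendsto (deriv f) atTop (𝓝 (deriv f T + ∫ s in Set.Ioi T, deriv (deriv f) s)) := by
  have hd2 : Differentiable ℝ (deriv f) := hf.differentiable_deriv_two
  have hc2 : Continuous (deriv (deriv f)) := by fun_prop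
  have h1 : Tendsto (fun t => deriv f T + ∫ s in T..t, deriv (deriv f) s) atTop
      (𝓝 (deriv f T + ∫ s in Set.Ioi T, deriv (deriv f) s)) :=
    tendsto_const_nhds.add (intervalIntegral_tendsto_integral_Ioi T hint tendsto_id)
  refine h1.congr fun t => ?_
  rw [intervalIntegral.integral_eq_sub_of_hasDerivAt (fun x _ => (hd2 x).hasDerivAt)
    (hc2.intervalIntegrable _ _)]
  abel

/-- **A — ASYMPTOTIC VELOCITIES FROM INTEGRABLE ESCAPE** (pure real analysis; the dissipative
Marchal–Saari "final velocities" lemma). `N` curves `ξᵢ ∈ C²(ℝ, ℝ³)`, `δ`-separated (`δ > 0`) and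
`V`-Lipschitz on `[T, ∞)`, obeying the near-Newtonian modulation law
`‖ξ̈ᵢ + Σ_{j≠i} Mⱼ(ξᵢ − ξⱼ)/dᵢⱼ³‖ ≤ κ Σ_{j≠i} (Mⱼ/dᵢⱼ²)(‖ξ̇ᵢ‖² + ‖ξ̇ⱼ‖² + (Σₗ Mₗ)/dᵢⱼ) + β` with `β`
integrable on `[T, ∞)`, whose pairwise escape rates `1/dᵢⱼ²` are integrable on `[T, ∞)`, have
asymptotic velocities: for every `i` there is `vᵢ` with `‖vᵢ‖ ≤ V`, `ξ̇ᵢ → vᵢ` and `t⁻¹ ξᵢ(t) → vᵢ`.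
No sign hypotheses on `V, κ, Mⱼ, β` are needed: the acceleration is dominated on `[T, ∞)` by the
integrable `(1 + |κ|(2V² + |Σₗ Mₗ|/δ)) Σ_{j≠i} |Mⱼ|/dᵢⱼ² + β`. -/
theorem stub_asymptoticVelocity : open scoped Topology in ∀ (N : ℕ) (M : Fin N → ℝ) (T δ V κ : ℝ) (ξ : Fin N → ℝ → EuclideanSpace ℝ (Fin 3)) (β : ℝ → ℝ), 0 < δ → (∀ i, ContDiff ℝ 2 (ξ i)) → (∀ t, T ≤ t → ∀ i j, i ≠ j → δ ≤ ‖ξ i t - ξ j t‖) → (∀ i s t, T ≤ s → s ≤ t → ‖ξ i t - ξ i s‖ ≤ V * (t - s)) → MeasureTheory.IntegrableOn β (Set.Ici T) → (∀ t, T ≤ t → ∀ i, ‖deriv (deriv (ξ i)) t + ∑ j ∈ Finset.univ.erase i, (M j / ‖ξ i t - ξ j t‖ ^ 3) • (ξ i t - ξ j t)‖ ≤ κ * (∑ j ∈ Finset.univ.erase i, M j / ‖ξ i t - ξ j t‖ ^ 2 * (‖deriv (ξ i) t‖ ^ 2 + ‖deriv (ξ j) t‖ ^ 2 + (∑ l,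 M l) / ‖ξ i t - ξ j t‖)) + β t) → (∀ i j, i ≠ j → MeasureTheory.IntegrableOn (fun t ↦ 1 / ‖ξ i t - ξ j t‖ ^ 2) (Set.Ici T)) → ∀ i, ∃ v : EuclideanSpace ℝ (Fin 3), ‖v‖ ≤ V ∧ Filter.Tendsto (deriv (ξ i)) Filter.atTop (nhds v) ∧ Filter.Tendsto (fun t : ℝ ↦ t⁻¹ • ξ i t) Filter.atTop (nhds v) := by
  intro N M T δ V κ ξ β hδ hξ hsep hLip hβ hlaw hint i
  -- (1) differentiability and the closed speed bound on `[T, ∞)`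
  have hdiff : ∀ j, Differentiable ℝ (ξ j) := fun j => (hξ j).differentiable two_ne_zero
  have hspeed : ∀ j t, T ≤ t → ‖deriv (ξ j) t‖ ≤ V := fun j t ht =>
    norm_deriv_le_of_right_lipschitz (hdiff j t) fun z hz => hLip j t z ht hz.le
  -- (2) domination of the acceleration on `[T, ∞)`
  have hbound : ∀ t, T ≤ t → ‖deriv (deriv (ξ i)) t‖ ≤
      (1 + |κ| * (V ^ 2 + V ^ 2 + |∑ l, M l| / δ)) *
        ∑ j ∈ Finset.univ.erase i, |M j| * (1 / ‖ξ i t - ξ j t‖ ^ 2) + β t := by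
    intro t ht
    have hd : ∀ j ∈ Finset.univ.erase i, δ ≤ ‖ξ i t - ξ j t‖ := fun j hj =>
      hsep t ht i j (Finset.ne_of_mem_erase hj).symm
    have hdpos : ∀ j ∈ Finset.univ.erase i, 0 < ‖ξ i t - ξ j t‖ := fun j hj =>
      hδ.trans_le (hd j hj)
    -- the Newtonian term: `‖(Mⱼ/d³) • (ξᵢ - ξⱼ)‖ = |Mⱼ|/d²`
    have hF : ‖∑ j ∈ Finset.univ.erase i, (M j / ‖ξ i t - ξ j t‖ ^ 3) • (ξ i t - ξ j t)‖ ≤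
        ∑ j ∈ Finset.univ.erase i, |M j| * (1 / ‖ξ i t - ξ j t‖ ^ 2) := by
      refine (norm_sum_le _ _).trans (le_of_eq (Finset.sum_congr rfl fun j hj => ?_))
      have h0 : ‖ξ i t - ξ j t‖ ≠ 0 := (hdpos j hj).ne'
      rw [norm_smul, Real.norm_eq_abs, abs_div, abs_of_pos (pow_pos (hdpos j hj) 3)]
      field_simp
    -- the slack term, bounded using the speed bound and `d ≥ δ`
    have hS : κ * (∑ j ∈ Finset.univ.erase i, M j / ‖ξ i t - ξ j t‖ ^ 2 *
        (‖deriv (ξ i) t‖ ^ 2 + ‖deriv (ξ j) t‖ ^ 2 + (∑ l, M l) / ‖ξ i t - ξ j t‖)) ≤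
        |κ| * (V ^ 2 + V ^ 2 + |∑ l, M l| / δ) *
          ∑ j ∈ Finset.univ.erase i, |M j| * (1 / ‖ξ i t - ξ j t‖ ^ 2) := by
      refine (le_abs_self _).trans ?_
      rw [abs_mul, mul_assoc]
      refine mul_le_mul_of_nonneg_left ?_ (abs_nonneg κ)
      refine (Finset.abs_sum_le_sum_abs _ _).trans ?_
      rw [Finset.mul_sum]
      refine Finset.sum_le_sum fun j hj => ?_
      have h0 := hdpos j hj
      have hX : |‖deriv (ξ i) t‖ ^ 2 + ‖deriv (ξ j) t‖ ^ 2 + (∑ l, M l) / ‖ξ i t - ξ j t‖| ≤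
          V ^ 2 + V ^ 2 + |∑ l, M l| / δ := by
        refine (abs_add_le _ _).trans
          (add_le_add ((abs_add_le _ _).trans (add_le_add ?_ ?_)) ?_)
        · rw [abs_pow, abs_norm]
          exact pow_le_pow_left₀ (norm_nonneg _) (hspeed i t ht) 2
        · rw [abs_pow, abs_norm]
          exact pow_le_pow_left₀ (norm_nonneg _) (hspeed j t ht) 2
        · rw [abs_div, abs_of_pos h0]
          exact div_le_div_of_nonneg_left (abs_nonneg _) hδ (hd j hj)
      rw [abs_mul, abs_div, abs_of_pos (pow_pos h0 2)]
      calc |M j| / ‖ξ i t - ξ j t‖ ^ 2 *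
            |‖deriv (ξ i) t‖ ^ 2 + ‖deriv (ξ j) t‖ ^ 2 + (∑ l, M l) / ‖ξ i t - ξ j t‖|
          ≤ |M j| / ‖ξ i t - ξ j t‖ ^ 2 * (V ^ 2 + V ^ 2 + |∑ l, M l| / δ) :=
            mul_le_mul_of_nonneg_left hX (by positivity)
        _ = (V ^ 2 + V ^ 2 + |∑ l, M l| / δ) * (|M j| * (1 / ‖ξ i t - ξ j t‖ ^ 2)) := by ring
    have h1 := norm_le_add_norm_add (deriv (deriv (ξ i)) t)
      (∑ j ∈ Finset.univ.erase i, (M j / ‖ξ i t - ξ j t‖ ^ 3) • (ξ i t - ξ j t))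
    have h2 := hlaw t ht i
    linarith
  -- (3) the dominating function is integrable on `[T, ∞)`, hence so is the acceleration
  have hgi : IntegrableOn (fun t => (1 + |κ| * (V ^ 2 + V ^ 2 + |∑ l, M l| / δ)) *
      ∑ j ∈ Finset.univ.erase i, |M j| * (1 / ‖ξ i t - ξ j t‖ ^ 2) + β t) (Set.Ici T) := by
    have h1 : ∀ j ∈ Finset.univ.erase i,
        IntegrableOn (fun t => |M j| * (1 / ‖ξ i t - ξ j t‖ ^ 2)) (Set.Ici T) := fun j hj =>
      (hint i j (Finset.ne_of_mem_erase hj).symm).integrable.const_mul |M j|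
    have h2 : IntegrableOn
        (fun t => ∑ j ∈ Finset.univ.erase i, |M j| * (1 / ‖ξ i t - ξ j t‖ ^ 2)) (Set.Ici T) :=
      integrable_finsetSum _ h1
    exact (h2.integrable.const_mul _).fun_add hβ.integrable
  have hacc : IntegrableOn (deriv (deriv (ξ i))) (Set.Ici T) := by
    have hc2 : Continuous (deriv (deriv (ξ i))) := by have := hξ i; fun_prop
    refine Integrable.mono' hgi hc2.aestronglyMeasurable ?_
    exact (ae_restrict_mem measurableSet_Ici).mono fun t ht => hbound t ht
  -- (4) the limiting velocity, its closed speed bound, and (5) the Cesàro statement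
  have hv := tendsto_deriv_of_integrableOn (hξ i) (hacc.mono_set Set.Ioi_subset_Ici_self)
  exact ⟨_, le_of_tendsto hv.norm ((eventually_ge_atTop T).mono fun t ht => hspeed i t ht), hv,
    tendsto_inv_smul_of_tendsto_deriv (hdiff i) hv⟩

end Summit.FinalStateConjecture.FinalStateConjecture.Theorems.DissipativeFinalMotions.DispersingCapture
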